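import Summits.ResolutionOfSingularities.ResolutionOfSingularities.Theses.IndSmooth
import Literature.AlgebraicGeometry.Resolution.ResolutionLU
import Literature.AlgebraicGeometry.Resolution.RankOneReductionProofs
import Literature.AlgebraicGeometry.Resolution.RegularLocalRingsNormal

/-!
# Disproof work file — crux `SmoothToUniformizing` (stmt-ResolutionOfSingularities-16088)

Crux-attack at birth (refuter / cdisprove, route `IndSmooth`, rank 3, THE INJECTIVITY UPGRADE):

> `SmoothToUniformizing := ∀ p prime, IndSmoothAt p → LurelAt p`, where
> `IndSmoothAt p` (= crux #2 `ValuativeSmoothing` at `p`): over every perfect `k` of char `p`, every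
> f.g. `R ⊆ O` (`O ⊇ k` a valuation ring of a f.g. field `K/k`) factors `R → T → O` through a SMOOTH
> `k`-algebra `T` (a "chart"); `LurelAt p` (= target `LurelPerfect` at `p`): every such `R` lies in
> a f.g. `A ⊆ O` with `Frac A = K`, regular at the centre `𝔪_O ∩ A` (a "model").

## Findings (index; every `theorem` below is kernel-checked: rc 0, NO `sorry`,
## axioms ⊆ {propext, Classical.choice, Quot.sound})

§0 `smoothToUniformizing_iff`, `valuativeSmoothing_iff`, `lurelPerfect_iff`,
   `uniformizingToSmooth_iff` — the crux, its antecedent (crux #2), its consequent (the target) and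
   the support converse, unfolded through the two predicates `HasChart O R` / `HasModel O R`
   (definitional, `Iff.rfl`).

§1 POSITION. `lurelAt_of_resolutionInChar` (any `p`, also `p = 0`): resolution in char `p` ⇒ the
   consequent, through the tree's `ResolutionInChar.relLocalUniformization` + `exists_affineModel`.
   Hence `smoothToUniformizing_of_lurelPerfect`, `smoothToUniformizing_of_resolutionOfSingularities`
   (**THE SUMMIT IMPLIES THE CRUX; the antecedent is not used**) and the contrapositives
   `not_resolutionOfSingularities_of_not`, `not_lurelPerfect_of_not`.
   `not_smoothToUniformizing_iff` / `anatomy_of_refutation`: **a refutation of this crux is EXACTLY a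
   prime `p` with (i) a PROOF of crux #2 `ValuativeSmoothing` at `p` (ind-smoothness of ALL valuation
   rings of ALL function fields over ALL perfect fields of char `p` — the printed open question,
   AntieauDatta2021 §4 / Tang2024 p.1) and (ii) a DISPROOF of relative local uniformization at `p`,
   which refutes `ResolutionInChar p` and the summit.** Neither half is available in any `p`; every
   case where (i) is known (char 0; Abhyankar places; trdeg ≤ 3; perfect `K`) is a case where (ii)
   is known to be impossible (LU holds there). This is why the crux resists: it is an honest
   reduction step between two open problems, dominated by the summit.

§2 LOAD-BEARING / DECORATIVE HYPOTHESES (mutations, all as theorems):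
   * `p.Prime` — DECORATIVE: `withoutPrime_iff : (∀ p, IndSmoothAt p → LurelAt p) ↔
     SmoothToUniformizing ∧ (IndSmoothAt 0 → LurelAt 0)` (a field has characteristic prime or `0`,
     so every other `p` is vacuous), and the `p = 0` conjunct holds modulo the in-tree named fact
     `Hironaka1964` (`lurelAt_zero_of_hironaka`, Zariski 1940 read backwards).
   * `hO : k ⊆ O` — REDUNDANT on both sides: implied by `R ≤ O` for any `k`-subalgebra `R`
     (`withoutHO_iff : WithoutHO ↔ SmoothToUniformizing`).
   * `Algebra.Smooth k T` in the antecedent — **THE lever**: with smoothness deleted the chart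
     `T := R` always exists (`hasChart_without_smooth`), so
     `withoutSmooth_iff_lurelPerfect : WithoutSmooth ↔ LurelPerfect` — the crux minus smoothness of
     the charts IS the open target. Any proof must use the smooth structure of `T` (its presentation /
     Jacobian), not merely the factorisation.
   * `∀ t, χ t ∈ O` in the antecedent — also a lever: deleting it leaves "`R ↪ K` factors through a
     smooth `T`", which generic smoothness supplies (`T := R_g`, `g ≠ 0` off the singular locus; `k`
     perfect) — so `WithoutMemO` is again the bare target (`withoutMemO_of_lurelPerfect` proved; the
     converse is generic smoothness, not in Mathlib — remark only).
   * `R.FG` — per chart REDUNDANT: a chart bounds `R` by the f.g. image `χ(T)` (`le_range_of_chart`,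
     `fg_range_of_chart`, `hasModel_of_chart_of_lurelAt`: the target handles any charted `R`);
     deleting it on both sides kills the antecedent instead (`R := O`).
   * `(⊤ : IntermediateField k K).FG` — load-bearing only as bookkeeping for `Frac A = K`:
     `not_pointwiseWithoutFG` (witness `k = 𝔽_p`, `K = 𝔽_p^alg`, `O = K`, `R = k`: the chart `T = k`
     exists, no f.g. `A` has `Frac A = K`).
   * `[PerfectField k]` — deleting it on both sides makes the crux VACUOUSLY TRUE: the antecedent
     without perfectness is refuted in the tree (sibling crux #2's landed negative lemma
     `Theorems/ValuativeSmoothing/Negative/FalseWithoutPerfectField.lean`: `k = 𝔽₂(t)`, `K = k(√t)`,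
     a retract of a smooth algebra is formally smooth hence separable); deleting it in the consequent
     only keeps the crux implied by the summit (`lurelAt_of_resolutionInChar` uses no perfectness).
   * POINTWISE form `Pointwise p` (chart for THIS `R` ⇒ model for THIS `R`): sits between the target
     and the crux (`pointwise_of_lurelAt`, `lurelAt_of_pointwise`); it is what a per-valuation-ring
     (GND-style) proof would establish.

§3 DEGENERATE INSTANCES ARE TRUE (no junk falsity): `hasModel_top` (trivial valuation `O = K`:
   centre `(0)`, the localisation is the field `K`), `hasChart_bot` / `hasChart_self_of_smooth`
   (the antecedent's data are inhabited), trdeg 0 is both-sides trivial (`O = K`).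
   §3b `hasChart_polyChart_range`: a NON-JUNK inhabitant of the chart interface at a non-trivial
   valuation ring — `R = k[X] ⊆ O_X ⊊ k(X)` (`X`-adic DVR), chart `T = k[X]`.

§4 LINE `birth` (skeleton `Lines/birth.lean`, not yet PICKED; pre-targets, no stub attacked as false):
   * `stub_valuativeJacobian` (flat `O ⊗_B Ω_{B/k}` ⇒ `B` regular at the centre) — TRUE on paper
     (checked: free of rank `trdeg`, minimal generators descend along the local map `B_𝔭 → O`,
     EGA IV 17.5.8(iii)); degenerate instance `O = K` checked in Lean: the flatness hypothesis is
     VACUOUS there (`flatKaehlerAlong_top`: modules over the field `O = K` are flat) but the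
     conclusion holds anyway (`valuativeJacobian_top`); dually stub 1's conclusion `FlatLevel p`
     holds at `O = K` for free (`flatLevel_top_case`, `B := R ⊔ A₀`).
     Its hypothesis `[PerfectField k]` IS load-bearing (paper witness, not formalised: `k = 𝔽_p(t)`,
     `B = k[x,y]/(x^p - t y^p) ⊆ K = Frac B`, `O` the `y`-adic valuation ring of `K = 𝔽_p(x/y, y)`:
     `Ω_{B/k}` is free of rank 2 so `O ⊗_B Ω_{B/k}` is flat, yet `B_{(x,y)}` has embedding dimension
     2 > 1 = dim).
   * `stub_flatKaehlerLevel` (`IndSmoothAt p → FlatLevel p`) is the crux again: `FlatLevel p ↔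
     LurelAt p` modulo stub 2 and its (true) converse, so §1–§2 apply to it verbatim; in particular
     it is implied by the summit and not refutable without refuting resolution in char `p`.
   §4b (line `birth` picked): `stub_valuativeJacobian_false_without_flat` — stub 2 minus its
     flatness hypothesis ("every f.g. model is regular at the centre") is FALSE: `k = 𝔽_p`,
     `K = 𝔽_p(X)`, `O` `X`-adic, `B = k[X^(p+1), X^p]`; equivalently the crux's conclusion cannot be
     sharpened to "the given model `R` is already regular at the centre". Stub 2's `hK`, `hfr`:
     decorative on paper; `[PerfectField k]`: load-bearing on paper (witness above).

Nothing here is a refutation; no `sorry`; no stub is claimed false (stub 2 is true; §4b kills only its flatness-free mutation).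
-/

open Summit.ResolutionOfSingularities.ResolutionOfSingularities.Theses
open Summit.ResolutionOfSingularities.ResolutionOfSingularities.Theses.IndSmooth
open Literature.AlgebraicGeometry.Resolution (RelLocalUniformization ResolutionInChar Hironaka1964
  exists_affineModel isFractionRing_of_le)
open IsLocalRing

set_option linter.dupNamespace false

namespace Summit.ResolutionOfSingularities.ResolutionOfSingularities.Cruxes.SmoothToUniformizing.Disproof

/-! ## §0 The crux at one prime: charts and models -/

section Predicates

variable {k K : Type} [Field k] [Field K] [Algebra k K]

/-- **A smooth chart of `R` into `O`**: the inclusion `R ↪ O` factors `R → T → O` through a smooth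
`k`-algebra `T` (verbatim the existential of crux #2 `ValuativeSmoothing`). -/
def HasChart (O : ValuationSubring K) (R : Subalgebra k K) : Prop :=
  ∃ (T : Type) (_ : CommRing T) (_ : Algebra k T), Algebra.Smooth k T ∧
    ∃ (ψ : R →ₐ[k] T) (χ : T →ₐ[k] K), (∀ t : T, χ t ∈ O) ∧ ∀ r : R, χ (ψ r) = (r : K)

/-- **A model of `K` inside `O` dominating `R`, regular at the centre** (verbatim the existential of
the target `LurelPerfect`). -/
def HasModel (O : ValuationSubring K) (R : Subalgebra k K) : Prop :=
  ∃ (A : Subalgebra k K) (h : A.toSubring ≤ O.toSubring), R ≤ A ∧ A.FG ∧ IsFractionRing A K ∧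
    IsRegularLocalRing
      (Localization.AtPrime (Ideal.comap (Subring.inclusion h) (maximalIdeal O)))

end Predicates

/-- **Ind-smoothness at `p`** — verbatim the antecedent of the crux (= `ValuativeSmoothing` at `p`). -/
def IndSmoothAt (p : ℕ) : Prop :=
  ∀ (k K : Type) [Field k] [CharP k p] [PerfectField k] [Field K] [Algebra k K],
    (⊤ : IntermediateField k K).FG → ∀ O : ValuationSubring K, (∀ c : k, algebraMap k K c ∈ O) →
    ∀ R : Subalgebra k K, R.FG → R.toSubring ≤ O.toSubring → HasChart O R

/-- **Relative local uniformization over perfect fields at `p`** — verbatim the consequent of the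
crux (= the target `LurelPerfect` at `p`). -/
def LurelAt (p : ℕ) : Prop :=
  ∀ (k K : Type) [Field k] [CharP k p] [PerfectField k] [Field K] [Algebra k K],
    (⊤ : IntermediateField k K).FG → ∀ O : ValuationSubring K, (∀ c : k, algebraMap k K c ∈ O) →
    ∀ R : Subalgebra k K, R.FG → R.toSubring ≤ O.toSubring → HasModel O R

/-- The crux unfolded (definitional). -/
theorem smoothToUniformizing_iff :
    SmoothToUniformizing ↔ ∀ p : ℕ, p.Prime → IndSmoothAt p → LurelAt p := Iff.rfl

/-- Crux #2 unfolded (definitional). -/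
theorem valuativeSmoothing_iff : ValuativeSmoothing ↔ ∀ p : ℕ, p.Prime → IndSmoothAt p := Iff.rfl

/-- The target unfolded (definitional). -/
theorem lurelPerfect_iff : LurelPerfect ↔ ∀ p : ℕ, p.Prime → LurelAt p := Iff.rfl

/-- The support converse unfolded (definitional): per valuation ring, models ⇒ charts. -/
theorem uniformizingToSmooth_iff :
    UniformizingToSmooth ↔ ∀ p : ℕ, p.Prime →
      ∀ (k K : Type) [Field k] [CharP k p] [PerfectField k] [Field K] [Algebra k K],
        (⊤ : IntermediateField k K).FG → ∀ O : ValuationSubring K,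
        (∀ c : k, algebraMap k K c ∈ O) →
        (∀ R : Subalgebra k K, R.FG → R.toSubring ≤ O.toSubring → HasModel O R) →
        ∀ R : Subalgebra k K, R.FG → R.toSubring ≤ O.toSubring → HasChart O R := Iff.rfl

/-! ## §1 Position: the consequent is implied by the summit; anatomy of a refutation -/

section Position

/-- **Resolution in characteristic `p` implies the consequent at `p`** (any `p`, primality unused):
enlarge `R` by an affine model `A₀ ⊆ O` of `K` (`exists_affineModel`), then apply the tree's
`ResolutionInChar.relLocalUniformization` (valuative criterion + resolution of `Spec (R ⊔ A₀)`). -/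
theorem lurelAt_of_resolutionInChar {p : ℕ} (h : ResolutionInChar.{0} p) : LurelAt p := by
  intro k K _ _ _ _ _ hKfg O hO R hRfg hRO
  obtain ⟨A₀, hA₀O, hA₀fg, hA₀fr⟩ := exists_affineModel k K hKfg O hO
  have hR'O : (R ⊔ A₀).toSubring ≤ O.toSubring := by
    let Oalg : Subalgebra k K := { O.toSubring with algebraMap_mem' := hO }
    change R ⊔ A₀ ≤ Oalg
    exact sup_le (fun x hx => hRO hx) (fun x hx => hA₀O hx)
  have hR'fr : IsFractionRing ↥(R ⊔ A₀) K := isFractionRing_of_le le_sup_right hA₀fr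
  obtain ⟨A, hA, hle, hAfg, hreg⟩ :=
    h.relLocalUniformization k K O (R ⊔ A₀) (hRfg.sup hA₀fg) hR'fr hR'O
  exact ⟨A, hA, le_sup_left.trans hle, hAfg, isFractionRing_of_le hle hR'fr, hreg⟩

/-- The `p = 0` consequent modulo the in-tree named fact `Hironaka1964` (Zariski 1940). -/
theorem lurelAt_zero_of_hironaka (h : Hironaka1964.{0}) : LurelAt 0 :=
  lurelAt_of_resolutionInChar h

/-- The target gives the crux outright (antecedent unused). -/
theorem smoothToUniformizing_of_lurelPerfect (h : LurelPerfect) : SmoothToUniformizing :=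
  fun p hp _ => h p hp

/-- **THE SUMMIT IMPLIES THE CRUX** (antecedent unused). -/
theorem smoothToUniformizing_of_resolutionOfSingularities (h : _root_.ResolutionOfSingularities) :
    SmoothToUniformizing :=
  fun p hp _ => lurelAt_of_resolutionInChar (h p hp)

/-- Contrapositive: **a refutation of the crux refutes resolution of singularities in positive
characteristic.** -/
theorem not_resolutionOfSingularities_of_not (h : ¬ SmoothToUniformizing) :
    ¬ _root_.ResolutionOfSingularities :=
  fun H => h (smoothToUniformizing_of_resolutionOfSingularities H)

/-- Contrapositive: a refutation of the crux refutes the route's target. -/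
theorem not_lurelPerfect_of_not (h : ¬ SmoothToUniformizing) : ¬ LurelPerfect :=
  fun H => h (smoothToUniformizing_of_lurelPerfect H)

/-- **Anatomy of a refutation**: `¬ crux` is exactly a prime at which crux #2 HOLDS and the target
FAILS. -/
theorem not_smoothToUniformizing_iff :
    ¬ SmoothToUniformizing ↔ ∃ p : ℕ, p.Prime ∧ IndSmoothAt p ∧ ¬ LurelAt p := by
  rw [smoothToUniformizing_iff]
  push Not
  rfl

/-- … and at that prime resolution in characteristic `p` fails too. -/
theorem anatomy_of_refutation (h : ¬ SmoothToUniformizing) :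
    ∃ p : ℕ, p.Prime ∧ IndSmoothAt p ∧ ¬ LurelAt p ∧ ¬ ResolutionInChar.{0} p := by
  obtain ⟨p, hp, hind, hlu⟩ := not_smoothToUniformizing_iff.mp h
  exact ⟨p, hp, hind, hlu, fun H => hlu (lurelAt_of_resolutionInChar H)⟩

end Position

/-! ## §2 Load-bearing and decorative hypotheses -/

section Mutations

/-! ### `p.Prime` is decorative -/

/-- The crux with `p.Prime` deleted. -/
def WithoutPrime : Prop := ∀ p : ℕ, IndSmoothAt p → LurelAt p

/-- For `p` neither prime nor zero no field has characteristic `p`: the consequent is vacuous. -/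
theorem lurelAt_of_not_prime {p : ℕ} (hp : ¬ p.Prime) (hp0 : p ≠ 0) : LurelAt p := by
  intro k K _ _ _ _ _
  rcases CharP.char_is_prime_or_zero k p with h | h
  · exact absurd h hp
  · exact absurd h hp0

/-- **`p.Prime` is decorative**: deleting it adds exactly the characteristic-zero instance. -/
theorem withoutPrime_iff :
    WithoutPrime ↔ SmoothToUniformizing ∧ (IndSmoothAt 0 → LurelAt 0) := by
  constructor
  · intro h
    exact ⟨fun p _ => h p, h 0⟩
  · rintro ⟨h, h0⟩ p
    by_cases hp : p.Prime
    · exact h p hp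
    · by_cases hp0 : p = 0
      · subst hp0
        exact h0
      · intro _
        exact lurelAt_of_not_prime hp hp0

/-- … and that instance holds modulo `Hironaka1964` (so `WithoutPrime ↔ crux` modulo Hironaka). -/
theorem withoutPrime_iff_of_hironaka (h07 : Hironaka1964.{0}) :
    WithoutPrime ↔ SmoothToUniformizing := by
  rw [withoutPrime_iff]
  exact ⟨fun h => h.1, fun h => ⟨h, fun _ => lurelAt_zero_of_hironaka h07⟩⟩

/-! ### `hO : k ⊆ O` is redundant (both sides) -/

/-- `k ⊆ O` follows from `R ≤ O` for any `k`-subalgebra `R`. -/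
theorem algebraMap_mem_of_le {k K : Type} [Field k] [Field K] [Algebra k K]
    (O : ValuationSubring K) (R : Subalgebra k K) (hRO : R.toSubring ≤ O.toSubring) (c : k) :
    algebraMap k K c ∈ O :=
  hRO (R.algebraMap_mem c)

/-- The crux with `hO` deleted from antecedent AND consequent. -/
def WithoutHO : Prop :=
  ∀ p : ℕ, p.Prime →
    (∀ (k K : Type) [Field k] [CharP k p] [PerfectField k] [Field K] [Algebra k K],
      (⊤ : IntermediateField k K).FG → ∀ O : ValuationSubring K,
      ∀ R : Subalgebra k K, R.FG → R.toSubring ≤ O.toSubring → HasChart O R) →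
    ∀ (k K : Type) [Field k] [CharP k p] [PerfectField k] [Field K] [Algebra k K],
      (⊤ : IntermediateField k K).FG → ∀ O : ValuationSubring K,
      ∀ R : Subalgebra k K, R.FG → R.toSubring ≤ O.toSubring → HasModel O R

/-- **`hO` is redundant**: the mutated crux is equivalent to the crux. -/
theorem withoutHO_iff : WithoutHO ↔ SmoothToUniformizing := by
  constructor
  · intro h p hp hind k K _ _ _ _ _ hK O _ R hR hRO
    exact h p hp (fun k K _ _ _ _ _ hK O R hR hRO =>
      hind k K hK O (algebraMap_mem_of_le O R hRO) R hR hRO) k K hK O R hR hRO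
  · intro h p hp hind k K _ _ _ _ _ hK O R hR hRO
    exact h p hp (fun k K _ _ _ _ _ hK O _ R hR hRO => hind k K hK O R hR hRO) k K hK O
      (algebraMap_mem_of_le O R hRO) R hR hRO

/-! ### `Algebra.Smooth k T` is THE lever of the antecedent -/

/-- Without smoothness a "chart" always exists: `T := R`, `ψ := id`, `χ :=` the inclusion. -/
theorem hasChart_without_smooth {k K : Type} [Field k] [Field K] [Algebra k K]
    (O : ValuationSubring K) (R : Subalgebra k K) (hRO : R.toSubring ≤ O.toSubring) :
    ∃ (T : Type) (_ : CommRing T) (_ : Algebra k T),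
      ∃ (ψ : R →ₐ[k] T) (χ : T →ₐ[k] K), (∀ t : T, χ t ∈ O) ∧ ∀ r : R, χ (ψ r) = (r : K) :=
  ⟨R, inferInstance, inferInstance, AlgHom.id k R, R.val, fun t => hRO t.2, fun _ => rfl⟩

/-- The crux with `Algebra.Smooth k T` deleted from the antecedent. -/
def WithoutSmooth : Prop :=
  ∀ p : ℕ, p.Prime →
    (∀ (k K : Type) [Field k] [CharP k p] [PerfectField k] [Field K] [Algebra k K],
      (⊤ : IntermediateField k K).FG → ∀ O : ValuationSubring K, (∀ c : k, algebraMap k K c ∈ O) →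
      ∀ R : Subalgebra k K, R.FG → R.toSubring ≤ O.toSubring →
      ∃ (T : Type) (_ : CommRing T) (_ : Algebra k T),
        ∃ (ψ : R →ₐ[k] T) (χ : T →ₐ[k] K), (∀ t : T, χ t ∈ O) ∧ ∀ r : R, χ (ψ r) = (r : K)) →
    LurelAt p

/-- **Smoothness of the charts is load-bearing**: without it the crux IS the open target
`LurelPerfect` (relative local uniformization over perfect fields), on the nose. -/
theorem withoutSmooth_iff_lurelPerfect : WithoutSmooth ↔ LurelPerfect := by
  constructor
  · intro h p hp
    exact h p hp (fun k K _ _ _ _ _ _ O _ R _ hRO => hasChart_without_smooth O R hRO)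
  · intro h p hp _
    exact h p hp

/-! ### `∀ t, χ t ∈ O` (the chart lands in `O`) -/

/-- The crux with the landing condition `χ(T) ⊆ O` deleted from the antecedent. -/
def WithoutMemO : Prop :=
  ∀ p : ℕ, p.Prime →
    (∀ (k K : Type) [Field k] [CharP k p] [PerfectField k] [Field K] [Algebra k K],
      (⊤ : IntermediateField k K).FG → ∀ O : ValuationSubring K, (∀ c : k, algebraMap k K c ∈ O) →
      ∀ R : Subalgebra k K, R.FG → R.toSubring ≤ O.toSubring →
      ∃ (T : Type) (_ : CommRing T) (_ : Algebra k T), Algebra.Smooth k T ∧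
        ∃ (ψ : R →ₐ[k] T) (χ : T →ₐ[k] K), ∀ r : R, χ (ψ r) = (r : K)) →
    LurelAt p

/-- The target gives `WithoutMemO` (antecedent unused). The converse — `WithoutMemO → LurelPerfect`
— is generic smoothness over a perfect field (`T := R_g` regular for some `g ≠ 0`), true but not
in Mathlib; so the landing condition, like smoothness, is a lever: without it the crux is the bare
target. -/
theorem withoutMemO_of_lurelPerfect (h : LurelPerfect) : WithoutMemO :=
  fun p hp _ => h p hp

/-! ### `R.FG` is redundant per chart -/

section Chart

variable {k K : Type} [Field k] [Field K] [Algebra k K]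

/-- A chart bounds `R` from above by the image of `T`. -/
theorem le_range_of_chart {R : Subalgebra k K} {T : Type} [CommRing T] [Algebra k T]
    (ψ : R →ₐ[k] T) (χ : T →ₐ[k] K) (h : ∀ r : R, χ (ψ r) = (r : K)) : R ≤ χ.range := by
  intro x hx
  exact ⟨ψ ⟨x, hx⟩, h ⟨x, hx⟩⟩

/-- … and that image is finitely generated (`T` is of finite presentation). -/
theorem fg_range_of_chart {T : Type} [CommRing T] [Algebra k T] [Algebra.Smooth k T]
    (χ : T →ₐ[k] K) : χ.range.FG := by
  haveI : Algebra.FiniteType k T := inferInstance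
  rw [← Algebra.map_top]
  exact Subalgebra.FG.map _ (Algebra.FiniteType.out)

/-- … and lands in `O` when the chart does. -/
theorem range_le_of_chart {T : Type} [CommRing T] [Algebra k T] (O : ValuationSubring K)
    (χ : T →ₐ[k] K) (hχ : ∀ t : T, χ t ∈ O) : χ.range.toSubring ≤ O.toSubring := by
  rintro x ⟨t, rfl⟩
  exact hχ t

/-- **`R.FG` is not load-bearing per chart**: the target alone gives a model dominating ANY
(possibly non-finitely-generated) `k`-subalgebra `R ⊆ O` that admits a smooth chart — apply the
target to the finitely generated image `χ(T) ⊇ R`. (Deleting `R.FG` on both sides of the crux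
instead kills the antecedent: `R := O` has no chart when `O` is not finitely generated.) -/
theorem hasModel_of_chart_of_lurelAt {p : ℕ} (hlu : LurelAt p) (k K : Type) [Field k] [CharP k p]
    [PerfectField k] [Field K] [Algebra k K] (hK : (⊤ : IntermediateField k K).FG)
    (O : ValuationSubring K) (hO : ∀ c : k, algebraMap k K c ∈ O) (R : Subalgebra k K)
    (hch : HasChart O R) : HasModel O R := by
  obtain ⟨T, _, _, _, ψ, χ, hχ, hψχ⟩ := hch
  obtain ⟨A, h, hle, hAfg, hAfr, hreg⟩ :=
    hlu k K hK O hO χ.range (fg_range_of_chart χ) (range_le_of_chart O χ hχ)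
  exact ⟨A, h, (le_range_of_chart ψ χ hψχ).trans hle, hAfg, hAfr, hreg⟩

end Chart

/-! ### The pointwise form and `(⊤ : IntermediateField k K).FG` -/

/-- **Pointwise form** of the crux at `p`: a chart for THIS `R` into THIS `O` ⇒ a model for it. -/
def Pointwise (p : ℕ) : Prop :=
  ∀ (k K : Type) [Field k] [CharP k p] [PerfectField k] [Field K] [Algebra k K],
    (⊤ : IntermediateField k K).FG → ∀ O : ValuationSubring K, (∀ c : k, algebraMap k K c ∈ O) →
    ∀ R : Subalgebra k K, R.FG → R.toSubring ≤ O.toSubring → HasChart O R → HasModel O R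

/-- The target gives the pointwise form (chart unused). -/
theorem pointwise_of_lurelAt {p : ℕ} (h : LurelAt p) : Pointwise p :=
  fun k K _ _ _ _ _ hK O hO R hR hRO _ => h k K hK O hO R hR hRO

/-- The pointwise form gives the crux at `p`. -/
theorem lurelAt_of_pointwise {p : ℕ} (h : Pointwise p) (hind : IndSmoothAt p) : LurelAt p :=
  fun k K _ _ _ _ _ hK O hO R hR hRO => h k K hK O hO R hR hRO (hind k K hK O hO R hR hRO)

/-- Hence `∀ p prime, Pointwise p` is a natural strengthening of the crux. -/
theorem smoothToUniformizing_of_pointwise (h : ∀ p : ℕ, p.Prime → Pointwise p) :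
    SmoothToUniformizing :=
  fun p hp hind => lurelAt_of_pointwise (h p hp) hind

/-- The bottom subalgebra `k ⊆ K` always has a chart into any `O ∋ k`: `T := k`. -/
theorem hasChart_bot {k K : Type} [Field k] [Field K] [Algebra k K] (O : ValuationSubring K)
    (hO : ∀ c : k, algebraMap k K c ∈ O) : HasChart O (⊥ : Subalgebra k K) := by
  refine ⟨(⊥ : Subalgebra k K), inferInstance, inferInstance, ?_, AlgHom.id k _,
    (⊥ : Subalgebra k K).val, ?_, fun _ => rfl⟩
  · exact Algebra.Smooth.of_equiv (Algebra.botEquiv k K).symm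
  · rintro ⟨x, hx⟩
    obtain ⟨c, rfl⟩ := Algebra.mem_bot.mp hx
    exact hO c

/-- A subalgebra that is itself smooth over `k` is its own chart. -/
theorem hasChart_self_of_smooth {k K : Type} [Field k] [Field K] [Algebra k K]
    (O : ValuationSubring K) (R : Subalgebra k K) [Algebra.Smooth k R]
    (hRO : R.toSubring ≤ O.toSubring) : HasChart O R :=
  ⟨R, inferInstance, inferInstance, inferInstance, AlgHom.id k R, R.val, fun t => hRO t.2,
    fun _ => rfl⟩

/-- The pointwise form with `(⊤ : IntermediateField k K).FG` deleted. -/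
def PointwiseWithoutFG (p : ℕ) : Prop :=
  ∀ (k K : Type) [Field k] [CharP k p] [PerfectField k] [Field K] [Algebra k K],
    ∀ O : ValuationSubring K, (∀ c : k, algebraMap k K c ∈ O) →
    ∀ R : Subalgebra k K, R.FG → R.toSubring ≤ O.toSubring → HasChart O R → HasModel O R

/-- **`K/k` finitely generated is load-bearing (bookkeeping for `Frac A = K`)**: witness `k = 𝔽_p`,
`K = 𝔽_p^alg`, `O = K`, `R = k`. The chart `T = k` exists (`hasChart_bot`); a finitely generated
`A ⊆ K` with `Frac A = K` would be integral, hence finite over `𝔽_p`, hence a finite field equal to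
`K` — but `K` is infinite. -/
theorem not_pointwiseWithoutFG (p : ℕ) [hp : Fact p.Prime] : ¬ PointwiseWithoutFG p := by
  intro H
  let k := ZMod p
  let K := AlgebraicClosure (ZMod p)
  have hO : ∀ c : k, algebraMap k K c ∈ (⊤ : ValuationSubring K) := fun _ => trivial
  have h₀ : (⊥ : Subalgebra k K).toSubring ≤ (⊤ : ValuationSubring K).toSubring :=
    fun _ _ => Subring.mem_top _
  obtain ⟨A, h, -, hAfg, hAfr, -⟩ := H k K ⊤ hO ⊥ Subalgebra.fg_bot h₀ (hasChart_bot ⊤ hO)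
  haveI : Algebra.FiniteType k A := A.fg_iff_finiteType.mp hAfg
  haveI : Algebra.IsIntegral k A := ⟨fun a =>
    (isIntegral_algHom_iff A.val Subtype.val_injective).mp (Algebra.IsIntegral.isIntegral (a : K))⟩
  haveI : Module.Finite k A := Algebra.IsIntegral.finite
  haveI : Finite A := Module.finite_of_finite k
  have hfield : IsField A := Finite.isField_of_domain A
  have hbij := hfield.localization_map_bijective (M := nonZeroDivisors A) (Rₘ := K)
    zero_notMem_nonZeroDivisors
  haveI : Finite K := Finite.of_surjective _ hbij.2
  exact not_finite K

end Mutations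

/-! ## §3 Degenerate instances are TRUE -/

section Degenerate

variable {k K : Type} [Field k] [Field K] [Algebra k K]

/-- The localisation of a Noetherian domain at the zero ideal is a regular local ring (a field). -/
theorem isRegularLocalRing_localization_of_eq_bot {R : Type*} [CommRing R] [IsDomain R]
    [IsNoetherianRing R] (I : Ideal R) [I.IsPrime] (hI : I = ⊥) :
    IsRegularLocalRing (Localization.AtPrime I) := by
  subst hI
  apply IsRegularLocalRing.of_spanFinrank_maximalIdeal_le
  have hm : maximalIdeal (Localization.AtPrime (⊥ : Ideal R)) = ⊥ := by
    rw [← Localization.AtPrime.map_eq_maximalIdeal, Ideal.map_bot]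
  rw [hm, Submodule.spanFinrank_bot]
  exact ringKrullDim_nonneg_of_nontrivial

/-- The centre of the trivial valuation ring `O = K` on any subring is the zero ideal. -/
theorem centre_top_eq_bot (A : Subalgebra k K)
    (h : A.toSubring ≤ (⊤ : ValuationSubring K).toSubring) :
    Ideal.comap (Subring.inclusion h) (maximalIdeal (⊤ : ValuationSubring K)) = ⊥ := by
  rw [maximalIdeal_eq_bot, Ideal.comap_bot_of_injective]
  exact Subring.inclusion_injective _

/-- **Trivial valuation (`O = K`)**: the consequent holds — enlarge `R` by an affine model of `K`;
the centre is `(0)` and the localisation is the field `K`. -/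
theorem hasModel_top (hK : (⊤ : IntermediateField k K).FG) (R : Subalgebra k K) (hR : R.FG) :
    HasModel (⊤ : ValuationSubring K) R := by
  have hO : ∀ c : k, algebraMap k K c ∈ (⊤ : ValuationSubring K) := fun _ => trivial
  obtain ⟨A₀, -, hA₀fg, hA₀fr⟩ := exists_affineModel k K hK ⊤ hO
  have h : (R ⊔ A₀).toSubring ≤ (⊤ : ValuationSubring K).toSubring := fun _ _ => Subring.mem_top _
  refine ⟨R ⊔ A₀, h, le_sup_left, hR.sup hA₀fg, isFractionRing_of_le le_sup_right hA₀fr, ?_⟩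
  haveI : IsNoetherianRing (R ⊔ A₀).toSubring := isNoetherianRing_of_fg (hR.sup hA₀fg)
  exact isRegularLocalRing_localization_of_eq_bot _ (centre_top_eq_bot _ h)

/-- Hence the crux's consequent at the trivial valuation, for every `p`. -/
theorem lurelAt_top_case (p : ℕ) (k K : Type) [Field k] [CharP k p] [PerfectField k] [Field K]
    [Algebra k K] (hK : (⊤ : IntermediateField k K).FG) (R : Subalgebra k K) (hR : R.FG)
    (_hRO : R.toSubring ≤ (⊤ : ValuationSubring K).toSubring) :
    HasModel (⊤ : ValuationSubring K) R :=
  hasModel_top hK R hR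

end Degenerate

/-! ## §3b A non-junk inhabitant of the antecedent's data: the `X`-adic DVR of `k(X)` -/

section Inhabitant

open Polynomial

variable (k : Type) [Field k]

/-- The `X`-adic valuation ring `O_X = k[X]_{(X)}` of `k(X)` (a DVR, not the whole field). -/
noncomputable def XadicO : ValuationSubring (RatFunc k) :=
  ((Polynomial.idealX k).valuation (RatFunc k)).valuationSubring

/-- The polynomial chart `k[X] → k(X)`. -/
noncomputable def polyChart : k[X] →ₐ[k] RatFunc k := IsScalarTower.toAlgHom k k[X] (RatFunc k)

theorem polyChart_apply (t : k[X]) : polyChart k t = algebraMap k[X] (RatFunc k) t := rfl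

theorem polyChart_injective : Function.Injective (polyChart k) := RatFunc.algebraMap_injective k

/-- Polynomials are `X`-adic integers. -/
theorem polyChart_mem (t : k[X]) : polyChart k t ∈ XadicO k := by
  rw [XadicO, Valuation.mem_valuationSubring_iff, polyChart_apply]
  exact (Polynomial.idealX k).valuation_le_one t

/-- `O_X ≠ k(X)`: `X⁻¹ ∉ O_X`. -/
theorem XadicO_ne_top : XadicO k ≠ ⊤ := by
  intro h
  have hX : (RatFunc.X : RatFunc k)⁻¹ ∈ XadicO k := by rw [h]; trivial
  rw [XadicO, Valuation.mem_valuationSubring_iff, map_inv₀, Polynomial.valuation_X_eq_neg_one,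
    ← WithZero.exp_neg, neg_neg, ← WithZero.exp_zero, WithZero.exp_le_exp] at hX
  omega

/-- **Non-junk inhabitant**: for `R = k[X] ⊆ O_X ⊊ k(X)` the antecedent's data `HasChart O_X R`
exist (chart `T = k[X]`, smooth; `ψ` the inverse of `k[X] ≅ R`, `χ` the inclusion). So the chart
interface is satisfiable at a NON-trivial valuation ring; of course this instance is also a model
(`k[X]` is regular) — the content of the crux is the singular centre. -/
theorem hasChart_polyChart_range :
    (polyChart k).range.toSubring ≤ (XadicO k).toSubring ∧ XadicO k ≠ ⊤ ∧
      HasChart (XadicO k) (polyChart k).range := by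
  refine ⟨?_, XadicO_ne_top k, ?_⟩
  · rintro x ⟨t, rfl⟩
    exact polyChart_mem k t
  · haveI : Algebra.Smooth k k[X] := {}
    let e := AlgEquiv.ofInjective (polyChart k) (polyChart_injective k)
    refine ⟨k[X], inferInstance, inferInstance, inferInstance, e.symm.toAlgHom, polyChart k,
      polyChart_mem k, fun r => ?_⟩
    have h := AlgEquiv.ofInjective_apply (polyChart k) (polyChart_injective k) (e.symm r)
    rw [AlgEquiv.apply_symm_apply] at h
    exact h.symm

end Inhabitant

-- Targets: none assigned yet (payload.targets = [], no PICKED.md); pre-targets from `Lines/birth.lean`.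
/-! ## §4 Targets / line `birth` (pre-pick): the valuative Jacobian stub at the trivial valuation -/

section Birth

variable {k K : Type} [Field k] [Field K] [Algebra k K]

/-- **`stub_valuativeJacobian` at `O = K` holds with the flatness hypothesis UNUSED** (it is vacuous
there: every module over the field `O = K` is flat): the centre is `(0)` and `B_{(0)} = K`. So the
trivial valuation is not a junk counterexample to stub 2, and flatness carries content only for
`O ≠ K`. -/
theorem valuativeJacobian_top (B : Subalgebra k K)
    (h : B.toSubring ≤ (⊤ : ValuationSubring K).toSubring) (hB : B.FG) :
    IsRegularLocalRing (Localization.AtPrime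
      (Ideal.comap (Subring.inclusion h) (maximalIdeal (⊤ : ValuationSubring K)))) := by
  haveI : IsNoetherianRing B.toSubring := isNoetherianRing_of_fg hB
  exact isRegularLocalRing_localization_of_eq_bot _ (centre_top_eq_bot _ h)


/-- Verbatim copy of `Lines.Birth.algebraMapOfLE` (the structure map `B → O`). -/
def algebraMapOfLE (B : Subalgebra k K) (O : ValuationSubring K) (h : B.toSubring ≤ O.toSubring) :
    (B : Type) →+* (O : Type) :=
  (B.val.toRingHom).codRestrict O.toSubring (fun b => h (Subalgebra.mem_toSubring.mpr b.2))

/-- Verbatim copy of `Lines.Birth.FlatKaehlerAlong` (Néron's measure vanishes along `O`: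
`O ⊗_B Ω_{B/k}` is `O`-flat); definitionally the skeleton's predicate. -/
def FlatKaehlerAlong (B : Subalgebra k K) (O : ValuationSubring K)
    (h : B.toSubring ≤ O.toSubring) : Prop :=
  letI : Algebra B O := (algebraMapOfLE B O h).toAlgebra
  Module.Flat O (TensorProduct B O (KaehlerDifferential k B))

/-- The trivial valuation ring `O = K` is a field. -/
theorem isField_top_valuationSubring : IsField (⊤ : ValuationSubring K) := by
  refine ⟨⟨0, 1, zero_ne_one⟩, mul_comm, fun {a} ha => ?_⟩
  have ha' : (a : K) ≠ 0 := fun h0 => ha (Subtype.ext h0)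
  exact ⟨⟨(a : K)⁻¹, trivial⟩, Subtype.ext (mul_inv_cancel₀ ha')⟩

/-- Every module over the trivial valuation ring `O = K` (a field) is flat. -/
theorem flat_of_module_top (M : Type*) [AddCommGroup M] [Module (⊤ : ValuationSubring K) M] :
    Module.Flat (⊤ : ValuationSubring K) M := by
  letI : Field (⊤ : ValuationSubring K) := isField_top_valuationSubring.toField
  infer_instance

/-- **At the trivial valuation Néron's measure is VACUOUS**: every `O ⊗_B Ω_{B/k}` is flat over the
field `O = K`. So `FlatKaehlerAlong` carries content only for `O ≠ K` (where flat = torsion-free),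
exactly like the regularity conclusion it replaces. -/
theorem flatKaehlerAlong_top (B : Subalgebra k K)
    (h : B.toSubring ≤ (⊤ : ValuationSubring K).toSubring) :
    FlatKaehlerAlong B (⊤ : ValuationSubring K) h := by
  letI : Algebra B (⊤ : ValuationSubring K) := (algebraMapOfLE B ⊤ h).toAlgebra
  show Module.Flat _ _
  exact flat_of_module_top _

/-- **Stub 1's conclusion `FlatLevel p` at `O = K` holds for free** (no ind-smoothness used):
`B := R ⊔ A₀` for an affine model `A₀` of `K`; flatness is automatic over the field `K`. No junk
falsity of `FlatLevel` at the trivial valuation. -/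
theorem flatLevel_top_case (hK : (⊤ : IntermediateField k K).FG) (R : Subalgebra k K) (hR : R.FG) :
    ∃ (B : Subalgebra k K) (h : B.toSubring ≤ (⊤ : ValuationSubring K).toSubring),
      R ≤ B ∧ B.FG ∧ IsFractionRing B K ∧ FlatKaehlerAlong B (⊤ : ValuationSubring K) h := by
  obtain ⟨A₀, -, hA₀fg, hA₀fr⟩ := exists_affineModel k K hK ⊤ (fun _ => trivial)
  exact ⟨R ⊔ A₀, fun _ _ => Subring.mem_top _, le_sup_left, hR.sup hA₀fg,
    isFractionRing_of_le le_sup_right hA₀fr, flatKaehlerAlong_top _ _⟩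

end Birth

-- Line birth: stub hypotheses (picked line `birth`, lead prover-line-stmt-ResolutionOfSingularities-16088-0)
/-! ## §4b Line `birth`: the flatness hypothesis of `stub_valuativeJacobian` is load-bearing

`stub_valuativeJacobian_false_without_flat` (landed copy proposed as
`Theorems/SmoothToUniformizing/Negative/StubValuativeJacobianFalseWithoutFlat.lean`): stub 2 with
`FlatKaehlerAlong B O h` deleted — "every finitely generated model of `K` in `O` is regular at the
centre" — is FALSE (cusp `k[X^(p+1), X^p]` at the `X`-adic centre of `𝔽_p(X)`). The same witness
shows the crux's conclusion cannot be sharpened to "the prescribed model `R` itself is regular at the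
centre" (take `R = B`): a proof must change the model. Stub 2's remaining hypotheses: `hK` and
`hfr` are decorative on paper (rank count with `trdeg_k Frac B`); `[PerfectField k]` is load-bearing
(paper witness in the module docstring §4); stub 2 itself is TRUE. -/

section LineBirth

open Polynomial Literature.AlgebraicGeometry.Resolution

/-- Every element of `k[X^(p+1), X^p] ⊆ k(X)` is a polynomial without linear term (`2 ≤ p`).
[folklore] -/
theorem exists_coeff_one_eq_zero_of_mem_adjoin {p : ℕ} (hp : 2 ≤ p) (k : Type) [Field k]
    {y : RatFunc k}
    (hy : y ∈ Algebra.adjoin k ({(RatFunc.X : RatFunc k) ^ (p + 1), RatFunc.X ^ p} :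
      Set (RatFunc k))) :
    ∃ q : k[X], q.coeff 1 = 0 ∧ algebraMap k[X] (RatFunc k) q = y := by
  induction hy using Algebra.adjoin_induction with
  | mem x hx =>
    rcases hx with rfl | rfl
    · refine ⟨X ^ (p + 1), ?_, by simp⟩
      rw [Polynomial.coeff_X_pow, if_neg]
      omega
    · refine ⟨X ^ p, ?_, by simp⟩
      rw [Polynomial.coeff_X_pow, if_neg]
      omega
  | algebraMap c => exact ⟨C c, Polynomial.coeff_C_succ, rfl⟩
  | add x y _ _ hx hy =>
    obtain ⟨qx, hqx, rfl⟩ := hx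
    obtain ⟨qy, hqy, rfl⟩ := hy
    exact ⟨qx + qy, by simp [hqx, hqy], by simp⟩
  | mul x y _ _ hx hy =>
    obtain ⟨qx, hqx, rfl⟩ := hx
    obtain ⟨qy, hqy, rfl⟩ := hy
    refine ⟨qx * qy, ?_, by simp⟩
    simp [Polynomial.coeff_mul, Finset.Nat.sum_antidiagonal_succ, hqx, hqy]

/-- **The flatness hypothesis of `stub_valuativeJacobian` (line `birth`) is load-bearing**: the stub
with `FlatKaehlerAlong B O h` deleted — "every finitely generated model `B ⊆ O` of `K` is regular at
the centre of `O`" (inline, verbatim otherwise) — is FALSE. Witness: `k = 𝔽_p`, `K = 𝔽_p(X)`, `O`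
the `X`-adic valuation ring, `B = k[X^(p+1), X^p]` (the cusp for `p = 2`): a regular local ring is
integrally closed, so `X` (with `X^p ∈ B`) would lie in `B` localised at the centre, `X = a/s`,
`a, s ∈ B`, `X ∤ s` — impossible, `B` has no linear terms. Equivalently: the crux's conclusion cannot
be sharpened to "the given model is already regular at the centre". [folklore] -/
theorem stub_valuativeJacobian_false_without_flat :
    ¬ (∀ (k K : Type) [Field k] [PerfectField k] [Field K] [Algebra k K],
        (⊤ : IntermediateField k K).FG →
        ∀ (O : ValuationSubring K) (B : Subalgebra k K) (h : B.toSubring ≤ O.toSubring),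
          B.FG → IsFractionRing B K →
          IsRegularLocalRing (Localization.AtPrime
            (Ideal.comap (Subring.inclusion h) (IsLocalRing.maximalIdeal O)))) := by
  classical
  intro H
  obtain ⟨p, hp⟩ : ∃ p : ℕ, p.Prime := ⟨2, Nat.prime_two⟩
  haveI : Fact p.Prime := ⟨hp⟩
  let k := ZMod p
  let K := RatFunc (ZMod p)
  let x : K := RatFunc.X
  let v : Valuation K (WithZero (Multiplicative ℤ)) := (Polynomial.idealX k).valuation K
  let O : ValuationSubring K := v.valuationSubring
  have hp0 : p ≠ 0 := hp.ne_zero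
  have hp2 : 2 ≤ p := hp.two_le
  -- polynomials lie in `O`
  have hpolyO : ∀ q : k[X], algebraMap k[X] K q ∈ O := fun q => by
    change v (algebraMap k[X] K q) ≤ 1
    rw [IsDedekindDomain.HeightOneSpectrum.valuation_of_algebraMap]
    exact IsDedekindDomain.HeightOneSpectrum.intValuation_le_one _ _
  have hxO : x ∈ O := by have := hpolyO X; rwa [RatFunc.algebraMap_X] at this
  have hkO : ∀ c : k, algebraMap k K c ∈ O := fun c => by
    have := hpolyO (C c); rwa [RatFunc.algebraMap_C] at this
  -- `K = k(X)` is finitely generated over `k`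
  have hKfg : (⊤ : IntermediateField k K).FG :=
    ⟨{RatFunc.X}, by rw [Finset.coe_singleton]; exact RatFunc.adjoin_X⟩
  -- the model `B = k[X^(p+1), X^p]`
  let B : Subalgebra k K := Algebra.adjoin k {x ^ (p + 1), x ^ p}
  have hBfg : B.FG := by
    simpa [B] using Subalgebra.fg_adjoin_finset ({x ^ (p + 1), x ^ p} : Finset K)
  have hBO : B.toSubring ≤ O.toSubring := by
    let Oalg : Subalgebra k K := { O.toSubring with algebraMap_mem' := hkO }
    change B ≤ Oalg
    refine Algebra.adjoin_le ?_
    rintro y (rfl | rfl)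
    · exact pow_mem hxO _
    · exact pow_mem hxO _
  -- `X^m ∈ B` for `m ≥ p²`, hence `X^(p²) · k[X] ⊆ B` and `Frac B = K`
  have hpow : ∀ q r : ℕ, r < p → x ^ (p ^ 2 + (p * q + r)) ∈ B := by
    intro q r hr
    induction q with
    | zero =>
      have hrp : r ≤ p := hr.le
      have : p ^ 2 + (p * 0 + r) = (p + 1) * r + p * (p - r) := by
        zify [hrp]; ring
      rw [this, pow_add, pow_mul, pow_mul]
      refine B.mul_mem (pow_mem ?_ _) (pow_mem ?_ _)
      · exact Algebra.subset_adjoin (by simp)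
      · exact Algebra.subset_adjoin (by simp)
    | succ q ih =>
      have : p ^ 2 + (p * (q + 1) + r) = p + (p ^ 2 + (p * q + r)) := by ring
      rw [this, pow_add]
      refine B.mul_mem ?_ ih
      exact Algebra.subset_adjoin (by simp)
  have hpow' : ∀ m : ℕ, x ^ (p ^ 2 + m) ∈ B := fun m => by
    have hm : m = p * (m / p) + m % p := (Nat.div_add_mod m p).symm
    rw [hm]
    exact hpow _ _ (Nat.mod_lt _ hp.pos)
  have hmul : ∀ q : k[X], x ^ (p ^ 2) * algebraMap k[X] K q ∈ B := by
    intro q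
    induction q using Polynomial.induction_on' with
    | add q₁ q₂ h₁ h₂ => rw [map_add, mul_add]; exact B.add_mem h₁ h₂
    | monomial n c =>
      rw [← Polynomial.C_mul_X_pow_eq_monomial, map_mul, map_pow, RatFunc.algebraMap_X,
        RatFunc.algebraMap_C, mul_left_comm, ← pow_add]
      have : (RatFunc.C c : K) = algebraMap k K c := rfl
      rw [this]
      exact B.mul_mem (B.algebraMap_mem c) (hpow' n)
  have hfr : IsFractionRing B K := by
    refine IsFractionRing.of_field B K fun z => ?_
    refine ⟨⟨_, hmul z.num⟩, ⟨_, hmul z.denom⟩, ?_⟩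
    have hx0 : (x ^ (p ^ 2) : K) ≠ 0 := pow_ne_zero _ RatFunc.X_ne_zero
    change z = (x ^ (p ^ 2) * algebraMap k[X] K z.num) / (x ^ (p ^ 2) * algebraMap k[X] K z.denom)
    rw [mul_div_mul_left _ _ hx0, RatFunc.num_div_denom]
  -- the mutated stub would make `B` regular at the centre
  have hregB := H k K hKfg O B hBO hBfg hfr
  -- then the local ring `Λ ⊆ K` of `B` at the centre is normal, so `X ∈ Λ`
  haveI : IsFractionRing B.toSubring K := hfr
  set Λ : Subalgebra B.toSubring K := Localization.subalgebra.ofField K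
    ((maximalIdeal O).comap (Subring.inclusion hBO)).primeCompl
    (Ideal.primeCompl_le_nonZeroDivisors _) with hΛ
  have hregΛ : IsRegularLocalRing Λ :=
    (isRegularLocalRing_iff_centreLocalization O B hBO).mp hregB
  haveI : IsIntegrallyClosed Λ := isIntegrallyClosed_of_isRegularLocalRing Λ
  have hxΛ : x ∈ Λ := by
    have hxpΛ : x ^ p ∈ Λ :=
      le_centreLocalization O B hBO (Algebra.subset_adjoin (by simp))
    have hint : IsIntegral Λ x :=
      ⟨Polynomial.X ^ p - Polynomial.C ⟨x ^ p, hxpΛ⟩, Polynomial.monic_X_pow_sub_C _ hp0, by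
        simp [Polynomial.eval₂_sub, Polynomial.eval₂_X_pow, Polynomial.eval₂_C]⟩
    obtain ⟨y, hy⟩ := IsIntegrallyClosed.algebraMap_eq_of_integral hint
    rw [← hy]
    exact y.2
  -- write `X = a / s` with `a, s ∈ B`, `v(s) = 1`
  rw [hΛ, mem_centreLocalization_iff] at hxΛ
  obtain ⟨a, ha, s, hs, hs1, hxas⟩ := hxΛ
  obtain ⟨qa, hqa1, rfl⟩ := exists_coeff_one_eq_zero_of_mem_adjoin hp2 k ha
  obtain ⟨qs, hqs1, rfl⟩ := exists_coeff_one_eq_zero_of_mem_adjoin hp2 k hs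
  -- `v(s) = 1` says `X ∤ qs`, i.e. `qs(0) ≠ 0`
  have hqs0 : qs.coeff 0 ≠ 0 := by
    have hv1 : v (algebraMap k[X] K qs) = 1 :=
      (Valuation.isEquiv_valuation_valuationSubring v).eq_one_iff_eq_one.mpr hs1
    rw [IsDedekindDomain.HeightOneSpectrum.valuation_of_algebraMap,
      IsDedekindDomain.HeightOneSpectrum.intValuation_eq_one_iff, Polynomial.idealX_span,
      Ideal.mem_span_singleton, Polynomial.X_dvd_iff] at hv1
    exact hv1
  -- `X * qs = qa`: compare the coefficients of `X¹`
  have hs0 : algebraMap k[X] K qs ≠ 0 := by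
    intro h0
    rw [h0, map_zero] at hs1
    exact zero_ne_one hs1
  have heqK : algebraMap k[X] K (X * qs) = algebraMap k[X] K qa := by
    rw [map_mul, RatFunc.algebraMap_X]
    change x * _ = _
    rw [hxas, inv_mul_cancel_right₀ hs0]
  have heq : X * qs = qa := RatFunc.algebraMap_injective k heqK
  have := congrArg (fun q : k[X] => q.coeff 1) heq
  simp only [Polynomial.coeff_X_mul, hqa1] at this
  exact hqs0 this


end LineBirth


end Summit.ResolutionOfSingularities.ResolutionOfSingularities.Cruxes.SmoothToUniformizing.Disproof
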